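import Summits.CriticalPhenomena.SAWScalingLimit.Theses.SAWTowerCount
import Literature.Probability.RandomPlanarGeometry.ConformalRestrictionHolds
import Literature.Probability.RandomPlanarGeometry.HullSubdomainPullback
import Literature.Probability.RandomPlanarGeometry.SAWScalingLimitFamily

/-!
# Line `birth` — registered skeleton for the crux `ExponentIdentifies` (stmt-CriticalPhenomena-7255)

Crux (FIXED; rank 4 of `route-CriticalPhenomena-SAWTowerCount`, decl
`Summit.CriticalPhenomena.SAWScalingLimit.Theses.SAWTowerCount.ExponentIdentifies`):

  `CorridorMassFiveEighths → ∀ P chordal, (lim) → (conf) → (restr) → (tame) → ∀ D, IsSLELaw (8/3) D (P D)`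

— the corridor mass-covariance exponent `5/8` (the route's target `X₀ = CorridorMassFiveEighths`)
REPLACES "carried by simple curves" in Lawler–Schramm–Werner's identification of a conformally
covariant restriction family as chordal SLE_{8/3}; `(tame)` = a.s. boundary avoidance + "simple
whenever the range is an arc" (no retracing).

## The cut (the route header's own two-layer plan
## `ExponentIdentifies ⇐ HullPullbackNonSimple → CorridorAlphaReadout → CurveFromHullNoRetrace`)

The tree PROVES [LSW03] p. 5 result 2 in the transposed vocabulary,
`Literature.Probability.RandomPlanarGeometry.LawlerSchrammWerner2003_holds : chordal → (conf) → (restr) →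
(a.s. simple ∧ boundary-avoiding) → ∀ D, IsSLELaw (8/3) D (P D)`, so the crux is EXACTLY the statement that
such a limit family is a.s. simple, and simplicity is to be read off the restriction EXPONENT. The line
introduces one quantity, the **restriction exponent of a chordal family over hull subdomains**
(`HasRestrictionExponent P α`: for every Dobrushin domain `D`, chordal uniformizing map `φ : ℍ → D`, hull
subdomain `D'` (tree: `MarkedDomain.IsHullSubdomain`) and restriction map `Φ_A` of the pulled-back hull
`A = closure (ℍ ∖ φ⁻¹ D')` (tree: `ConformalEquiv.pullbackHull`, `IsRestrictionMap`, `HasRestrictionDeriv`),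
`P D {range ∩ closure (D ∖ D') = ∅} = Φ'_A(0) ^ α` — [LSW03] Prop. 3.3 (3) read in the domain, on the
AVOIDANCE event, which is the paper's `{K ∩ A = ∅}`), and cuts the crux into three genuine lemmas:

* S1 `stub_hullExponent` (HullPullbackNonSimple) — **a chordal, conformally covariant restriction family whose
  curves avoid the boundary has a restriction exponent `α > 0`**: [LSW03] Prop. 3.3 (1) ⇒ (3) (PROVED in the
  tree on `Ω`: `exists_isRestrictionMeasure_of_isHullMultiplicative_holds`) applied to the law of the FILLED
  pulled-back trace `fill (φ⁻¹(range ∩ D))`, which lies in [LSW]'s `Ω` by boundary avoidance alone (no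
  simplicity: the tree's `pullbackConfig / pullbackLaw` are built on the simple chordal carrier and must be
  redone with the fill); scale invariance from conformal covariance (transport between uniformizing maps, as
  `ChordalFamily.pullbackLaw_eq_of_covariant`), hull multiplicativity from restriction over hull subdomains,
  where the closed event `{range ⊆ closure D'}` of `IsRestriction` and the avoidance event differ by the
  touching event, null by the restriction identity applied to it plus boundary avoidance IN `D'`. Size M–L.
* S2 `stub_corridorReadout` (CorridorAlphaReadout; HARDEST, the route's lever) — **the corridor target pins the
  exponent: `CorridorMassFiveEighths →` for every full SAW scaling-limit family `P` (`SAW.IsScalingLimitFamily P`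
  = chordal ∧ (lim), `Iff.rfl`) and every `α`, `HasRestrictionExponent P α → α = 5/8`**. Proof plan: the
  corridor pair `D = ((0,m)×(0,1); iy, m+iy')  ⊋  D'_ε = ((0,m)×(0,1−ε); same marks)` is a hull subdomain
  (`y, y' < 1−ε`); `Φ'_{A_ε}(0) = H_{D'_ε}(a,b)/H_D(a,b) =: d_ε ∈ (0,1)` (boundary Poisson kernel ratio — the
  restriction map is normalised by `Φ(z)/z → 1` at `∞ ↦ b`), continuous in `ε`, and `H` of the rectangle is
  the sine series inlined in `X₀` (up to `2π`), with `H_{λR}(λa,λb) = λ⁻² H_R(a,b)`; on the lattice side,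
  along the endpoint approximation "row `⌊yn⌋` of the first interior column", `P_δ^D(γ avoids / stays below
  height 1−ε) = Z_{n'}(…)/Z_n(…)` with `n' = ⌊(1−ε)n⌋` rows (one-row discrepancies between the open and the
  closed event), whose limit is `(1−ε)^{-5/4} (H_{m/(1−ε)}(y/(1−ε), y'/(1−ε))/H_m(y,y'))^{5/8} = d_ε^{5/8}` by
  `X₀` (local uniformity in `(m,y,y')` + regular variation of `A(n)` of index `5/4` absorb the `n ↔ n−1`
  bookkeeping); portmanteau for the open avoidance event and the closed stay-inside event under `(lim)`
  (`TendstoLaw`, `CurveClass.isOpen_rangeSubset` / `isClosed_rangeSubset`) squeezes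
  `d_ε^α = P D(avoid_ε) ≤ d_ε^{5/8} ≤ P D(range ⊆ cl D'_ε) = inf_{η<ε} d_η^α = d_ε^α`, whence `α = 5/8`
  since `0 < d_ε < 1`. Needs: corridor Dobrushin domains (polygonal Jordan curve + two marks), the Poisson-kernel
  identification of `Φ'_A(0)`, and the mesh bookkeeping `SAW.law ((0,m)×(0,1)) (1/n) ↔ Z_n`. Size L.
* S3 `stub_simpleOfExponent` (CurveFromHullNoRetrace) — **exponent `5/8` + tameness ⇒ a.s. simple**: with
  exponent `5/8` on all hull subdomains the filled pull-back law is `P_{5/8}` (smooth hulls suffice: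
  `IsArcHullMultiplicative.isHullMultiplicative`, `RestrictionConfig.ext_of_avoid`), which is the law of the
  SLE_{8/3} trace (`IsRestrictionMeasure.exists_eq_map_sleTrace_eightThirds`, [LSW03] Thm. 6.1 + uniqueness,
  in the tree), a simple path from `0` to `∞`; so a.s. `fill(φ⁻¹(range ∩ D))` is a simple path, hence has
  empty interior, hence equals `φ⁻¹(range ∩ D)` (filling only adds open components), hence `range = ` a closed
  Jordan arc from `a` to `b` (Carathéodory at the two ends + boundary avoidance), i.e. `Icc 0 1 ≃ₜ range`,
  and the no-retrace clause of `(tame)` gives `γ ∈ CurveClass.simple`. Size M–L.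

`ExponentIdentifies_of` (kernel-checked, no `sorry` of its own): from `(tame)` extract boundary avoidance,
S1 gives `α`, S2 (fed `X₀` and `⟨chordal, lim⟩`) gives `α = 5/8`, S3 gives a.s. simplicity, and
`LawlerSchrammWerner2003_holds` concludes `IsSLELaw (8/3) D (P D)` — the conclusion is the route decl BY NAME.

Costume / shredding check: no stub mentions `IsSLELaw` or `SAWScalingLimit`; S1 and S3 do not mention the
lattice at all (pure conformal-restriction theory for NON-simple curves, absent from the tree, whose whole
[LSW03] development is on the simple chordal carrier); S2 is the only place `X₀` and `(lim)` enter and it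
concludes a bare equation `α = 5/8`. Each stub is strictly weaker than the crux-with-LSW and none implies the
crux or the summit conjunct by `exact? | simpa | aesop` (BC3 probes, recorded in the line card).
Disproof used: none — `ledger crux ls stmt-CriticalPhenomena-7255` shows no `Disproof.lean` and no dead
lines (2026-08-17); negatives index (11 entries) has no restriction-exponent / simplicity statement.
Inputs already PROVED in the tree and to be used by name, not re-stubbed: `LawlerSchrammWerner2003_holds`,
`exists_isRestrictionMeasure_of_isHullMultiplicative_holds`, `IsStarHull.pullbackHull`,
`IsStarHull.existsUnique_isRestrictionMap_holds`, `IsStarHull.exists_hasRestrictionDeriv_holds`,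
`JordanDomain.isSimplyConnected_holds`, `IsRestrictionMeasure.unique`,
`IsRestrictionMeasure.exists_eq_map_sleTrace_eightThirds`, `SAW.exists_isEndpointApprox`,
`CurveClass.isOpen_rangeSubset`, `CurveClass.isClosed_rangeSubset`.
-/

noncomputable section

open MeasureTheory Filter Topology Set
open UpperHalfPlane (upperHalfPlaneSet)
open Literature.Probability.RandomPlanarGeometry Literature.Probability.LatticeModels
open Summit.CriticalPhenomena.SAWScalingLimit.Theses.SAWTowerCount (CorridorMassFiveEighths)

namespace Summit.CriticalPhenomena.SAWScalingLimit.Cruxes.ExponentIdentifies.Birth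

/-! ### Vocabulary of the line -/

/-- **Restriction exponent of a chordal family over hull subdomains** ([LSW03] Prop. 3.3 (3) / Def. 3.4,
read in a Dobrushin domain): for every `(D; a, b)`, every chordal uniformizing map `φ : (ℍ; 0, ∞) → (D; a, b)`,
every hull subdomain `D'` (same marks, `D ∖ D'` away from `a` and `b`) and every restriction map `Φ` of the
pulled-back hull `A = closure (ℍ ∖ φ⁻¹ D')` with `Φ'_A(0) = d`, the probability that the curve of `P D`
AVOIDS `closure (D ∖ D')` (the paper's event `{K ∩ A = ∅}`) is `d ^ α`. -/
def HasRestrictionExponent (P : ChordalFamily) (α : ℝ) : Prop :=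
  ∀ (D D' : DobrushinDomain) (φ : ConformalEquiv upperHalfPlaneSet D.carrier)
    (Φ : ConformalEquiv (upperHalfPlaneSet \ φ.pullbackHull D') upperHalfPlaneSet) (d : ℝ),
    D.IsChordalUniformizing φ → D.IsHullSubdomain D' →
    IsRestrictionMap (φ.pullbackHull D') Φ → HasRestrictionDeriv (φ.pullbackHull D') Φ d →
      P D (CurveClass.rangeSubset (closure (D.carrier \ D'.carrier))ᶜ) = ENNReal.ofReal (d ^ α)

/-- Boundary avoidance (first clause of the crux's tameness hypothesis): `P D`-a.s. the trace meets `∂D`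
only inside `{a, b}`. -/
def BoundaryAvoiding (P : ChordalFamily) : Prop :=
  ∀ D : DobrushinDomain, ∀ᵐ γ ∂(P D), γ.range ∩ frontier D.carrier ⊆ {D.pt 0, D.pt 1}

/-- Tameness (verbatim the crux's hypothesis, = route item `TameOfLimit`'s conclusion for `P`): a.s. boundary
avoidance, and simplicity whenever the range is an arc (no retracing). -/
def Tame (P : ChordalFamily) : Prop :=
  ∀ D : DobrushinDomain, ∀ᵐ γ ∂(P D),
    γ.range ∩ frontier D.carrier ⊆ {D.pt 0, D.pt 1} ∧
      (Nonempty (Set.Icc (0 : ℝ) 1 ≃ₜ γ.range) → γ ∈ CurveClass.simple)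

/-- Tameness contains boundary avoidance. -/
theorem Tame.boundaryAvoiding {P : ChordalFamily} (h : Tame P) : BoundaryAvoiding P :=
  fun D => (h D).mono fun _ hγ => hγ.1

/-- **S1, named.** Chordal + conformally covariant + restriction + boundary-avoiding ⇒ some exponent `α > 0`. -/
def HullExponent : Prop :=
  ∀ P : ChordalFamily, P.IsChordal → P.IsConformallyCovariant → P.IsRestriction → BoundaryAvoiding P →
    ∃ α : ℝ, 0 < α ∧ HasRestrictionExponent P α

/-- **S2, named.** The corridor target `X₀` pins the exponent of every full SAW scaling-limit family to `5/8`. -/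
def CorridorReadout : Prop :=
  CorridorMassFiveEighths → ∀ P : ChordalFamily, SAW.IsScalingLimitFamily P →
    ∀ α : ℝ, HasRestrictionExponent P α → α = 5 / 8

/-- **S3, named.** Exponent `5/8` + conformal covariance + restriction + tameness ⇒ a.s. simple. -/
def SimpleOfExponent : Prop :=
  ∀ P : ChordalFamily, P.IsChordal → P.IsConformallyCovariant → P.IsRestriction → Tame P →
    HasRestrictionExponent P (5 / 8) → ∀ D : DobrushinDomain, ∀ᵐ γ ∂(P D), γ ∈ CurveClass.simple

/-! ### The stubs (the ONLY `sorry`s of this file)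

Each stub is stated over TREE VOCABULARY ONLY (`HasRestrictionExponent`, `BoundaryAvoiding`, `Tame` unfolded by
hand; `ChordalFamily.IsConformallyCovariant / IsRestriction`, `SAW.IsScalingLimitFamily`,
`MarkedDomain.IsChordalUniformizing / IsHullSubdomain`, `ConformalEquiv.pullbackHull`, `IsRestrictionMap`,
`HasRestrictionDeriv` are tree declarations), so that it lands verbatim as
`Theorems/SAWTowerCountExponentIdentifies<Stub>.lean --supports stmt-CriticalPhenomena-7255`; the `*_holds`
theorems below certify definitionally that the unfolded text IS the named statement. -/

/-- **S1 — HullPullbackNonSimple: a boundary-avoiding restriction family has a restriction exponent.**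
For a chordal, conformally covariant family with two-sided restriction whose curves a.s. meet `∂D` only at
the marked points, the law of the FILLED pulled-back trace `fill (φ⁻¹(range ∩ D))` is a probability measure on
[LSW03]'s `Ω` (connected, unbounded, `cl ∩ ℝ = {0}` by boundary avoidance, full by filling) which is dilation
invariant (conformal covariance + transport between uniformizing maps) and hull multiplicative (restriction over
hull subdomains; the touching event separating `{range ⊆ cl D'}` from the avoidance event is null by the
restriction identity applied to it and boundary avoidance in `D'`), hence is `P_α` for some `α > 0` by
Prop. 3.3 (1) ⇒ (3) (`exists_isRestrictionMeasure_of_isHullMultiplicative_holds`); unwinding the pull-back on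
the avoidance event of `A = φ.pullbackHull D'` (a `*`-hull: `IsStarHull.pullbackHull`) is the displayed formula. -/
theorem stub_hullExponent :
    ∀ P : ChordalFamily, P.IsChordal → P.IsConformallyCovariant → P.IsRestriction →
      (∀ D : DobrushinDomain, ∀ᵐ γ ∂(P D), γ.range ∩ frontier D.carrier ⊆ {D.pt 0, D.pt 1}) →
      ∃ α : ℝ, 0 < α ∧
        ∀ (D D' : DobrushinDomain) (φ : ConformalEquiv upperHalfPlaneSet D.carrier)
          (Φ : ConformalEquiv (upperHalfPlaneSet \ φ.pullbackHull D') upperHalfPlaneSet) (d : ℝ),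
          D.IsChordalUniformizing φ → D.IsHullSubdomain D' →
          IsRestrictionMap (φ.pullbackHull D') Φ → HasRestrictionDeriv (φ.pullbackHull D') Φ d →
            P D (CurveClass.rangeSubset (closure (D.carrier \ D'.carrier))ᶜ) =
              ENNReal.ofReal (d ^ α) := by
  sorry

/-- **S2 (hardest) — CorridorAlphaReadout: the corridor target pins the exponent to `5/8`.** Under
`X₀ = CorridorMassFiveEighths`, every full scaling-limit family `P` of the critical `δℤ²` SAW
(`SAW.IsScalingLimitFamily P`: chordal + `(lim)` for every Dobrushin domain and endpoint approximation) with a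
restriction exponent `α` has `α = 5/8`: on the corridor pair `((0,m)×(0,1); iy, m+iy') ⊋ ((0,m)×(0,1−ε); …)`
(a hull subdomain for `y, y' < 1−ε`) the exponent formula gives `P D(avoid_ε) = d_ε^α` with
`d_ε = Φ'_{A_ε}(0) = H_{D'_ε}(a,b)/H_D(a,b) ∈ (0,1)` continuous in `ε` (boundary Poisson kernels; `H` of the
rectangle is the sine series of `X₀` up to `2π`, and `H_{λR}(λa,λb) = λ⁻²H_R(a,b)`), while `(lim)` along the
approximation "row `⌊yn⌋` of the first interior column" and portmanteau (open avoidance event / closed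
stay-inside event) squeeze `P D(avoid_ε) ≤ lim Z_{⌊(1−ε)n⌋}(…)/Z_n(…) ≤ P D(range ⊆ cl D'_ε) = inf_{η<ε} d_η^α`,
the middle limit being `(1−ε)^{-5/4}(H_{m/(1−ε)}(y/(1−ε),y'/(1−ε))/H_m(y,y'))^{5/8} = d_ε^{5/8}` by `X₀`
(local uniformity + regular variation of `A(n)` absorb the `n ↔ n−1`, column-shift bookkeeping); so
`d_ε^α = d_ε^{5/8}` with `0 < d_ε < 1`. -/
theorem stub_corridorReadout :
    CorridorMassFiveEighths → ∀ P : ChordalFamily, SAW.IsScalingLimitFamily P → ∀ α : ℝ,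
      (∀ (D D' : DobrushinDomain) (φ : ConformalEquiv upperHalfPlaneSet D.carrier)
          (Φ : ConformalEquiv (upperHalfPlaneSet \ φ.pullbackHull D') upperHalfPlaneSet) (d : ℝ),
          D.IsChordalUniformizing φ → D.IsHullSubdomain D' →
          IsRestrictionMap (φ.pullbackHull D') Φ → HasRestrictionDeriv (φ.pullbackHull D') Φ d →
            P D (CurveClass.rangeSubset (closure (D.carrier \ D'.carrier))ᶜ) =
              ENNReal.ofReal (d ^ α)) →
      α = 5 / 8 := by
  sorry

/-- **S3 — CurveFromHullNoRetrace: exponent `5/8` and tameness force simple curves.** For a chordal,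
conformally covariant restriction family which is tame (a.s. boundary-avoiding, and simple whenever its range is
an arc) and has restriction exponent `5/8`, the filled pull-back law is `P_{5/8}` (formula on smooth hulls ⇒ on
all `*`-hulls by `IsArcHullMultiplicative.isHullMultiplicative`-type approximation; uniqueness
`IsRestrictionMeasure.unique` / `RestrictionConfig.ext_of_avoid`), i.e. the law of the SLE_{8/3} trace
(`IsRestrictionMeasure.exists_eq_map_sleTrace_eightThirds`, [LSW03] Thm. 6.1), a simple path from `0` to `∞`;
a filled set which is a simple path has empty interior, so nothing was filled and `φ⁻¹(range ∩ D)` itself is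
that path; with boundary avoidance and Carathéodory at `0 ↦ a`, `∞ ↦ b`, `range` is a Jordan arc from `a` to
`b` (`Icc 0 1 ≃ₜ range`), and the no-retrace clause gives `γ ∈ CurveClass.simple`. -/
theorem stub_simpleOfExponent :
    ∀ P : ChordalFamily, P.IsChordal → P.IsConformallyCovariant → P.IsRestriction →
      (∀ D : DobrushinDomain, ∀ᵐ γ ∂(P D),
        γ.range ∩ frontier D.carrier ⊆ {D.pt 0, D.pt 1} ∧
          (Nonempty (Set.Icc (0 : ℝ) 1 ≃ₜ γ.range) → γ ∈ CurveClass.simple)) →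
      (∀ (D D' : DobrushinDomain) (φ : ConformalEquiv upperHalfPlaneSet D.carrier)
          (Φ : ConformalEquiv (upperHalfPlaneSet \ φ.pullbackHull D') upperHalfPlaneSet) (d : ℝ),
          D.IsChordalUniformizing φ → D.IsHullSubdomain D' →
          IsRestrictionMap (φ.pullbackHull D') Φ → HasRestrictionDeriv (φ.pullbackHull D') Φ d →
            P D (CurveClass.rangeSubset (closure (D.carrier \ D'.carrier))ᶜ) =
              ENNReal.ofReal (d ^ (5 / 8 : ℝ))) →
      ∀ D : DobrushinDomain, ∀ᵐ γ ∂(P D), γ ∈ CurveClass.simple := by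
  sorry

/-! ### Consistency: each named statement IS its registered stub (definitionally) -/

theorem hullExponent_holds : HullExponent := stub_hullExponent
theorem corridorReadout_holds : CorridorReadout := stub_corridorReadout
theorem simpleOfExponent_holds : SimpleOfExponent := stub_simpleOfExponent

/-! ### Name-keyed aliases of the three statements — the hypotheses of `ExponentIdentifies_of`

The native skeleton audit (`#h21_check_skeleton`) admits a hypothesis of the skeleton theorem only if its head
constant is a registered obligation or is NAMED like a declared stub; `__Registered.stub_X` is the statement of
`stub_X` under that name (device of `Cruxes/AxiomsOfLimit/Lines/birth.lean`). Each alias is `rfl`-equal to its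
statement. -/
namespace __Registered

/-- Alias of `HullExponent` keyed by the registered stub name. -/
abbrev stub_hullExponent : Prop := HullExponent
/-- Alias of `CorridorReadout` keyed by the registered stub name. -/
abbrev stub_corridorReadout : Prop := CorridorReadout
/-- Alias of `SimpleOfExponent` keyed by the registered stub name. -/
abbrev stub_simpleOfExponent : Prop := SimpleOfExponent

end __Registered

/-! ### The skeleton theorem: the three stubs imply the crux, BY NAME -/

/-- **`ExponentIdentifies` from the line `birth`** (kernel-checked, no `sorry` of its own): given `X₀` and a
chordal `P` with `(lim)`, `(conf)`, `(restr)`, `(tame)` — boundary avoidance is the first clause of `(tame)`;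
S1 gives an exponent `α`; S2, fed `X₀` and the bundle `⟨chordal, lim⟩ : SAW.IsScalingLimitFamily P`, gives
`α = 5/8`; S3 gives a.s. simplicity; and [LSW03] p. 5 result 2, PROVED in the tree as
`LawlerSchrammWerner2003_holds`, identifies `P D` as the chordal SLE_{8/3} law. Hypotheses = the three stubs
under their registered names; conclusion = the route decl, by name. -/
theorem ExponentIdentifies_of (hA : __Registered.stub_hullExponent)
    (hB : __Registered.stub_corridorReadout) (hC : __Registered.stub_simpleOfExponent) :
    Summit.CriticalPhenomena.SAWScalingLimit.Theses.SAWTowerCount.ExponentIdentifies := by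
  intro hX P hP hlim hconf hrestr htame D
  have hba : BoundaryAvoiding P := fun D' => (htame D').mono fun _ hγ => hγ.1
  obtain ⟨α, -, hexp⟩ := hA P hP hconf hrestr hba
  have hα : α = 5 / 8 := hB hX P ⟨hP, hlim⟩ α hexp
  subst hα
  have hsimple : ∀ D' : DobrushinDomain, ∀ᵐ γ ∂(P D'), γ ∈ CurveClass.simple :=
    hC P hP hconf hrestr htame hexp
  exact LawlerSchrammWerner2003_holds P hP hconf hrestr (fun D' => (hsimple D').and (hba D')) D

/-- Wiring check (an `example`, so that `ExponentIdentifies_of` stays the only theorem concluding the crux):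
the registered stubs, with their tree-vocabulary types, feed the skeleton theorem as stated — this term becomes
the crux proof when the three `sorry`s above are discharged. -/
example : Summit.CriticalPhenomena.SAWScalingLimit.Theses.SAWTowerCount.ExponentIdentifies :=
  ExponentIdentifies_of stub_hullExponent stub_corridorReadout stub_simpleOfExponent

end Summit.CriticalPhenomena.SAWScalingLimit.Cruxes.ExponentIdentifies.Birth

end
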